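import Summits.Langlands.Langlands.Theses.EvenIcosahedralCMCorner
import Literature.FieldTheory.AlgClosed.PadicAlgClEquivComplex
import HarnessLib

/-!
# `EvenIcosahedralCMCorner.SectorReduction` (stmt-Langlands-14441) — the body of `closes`, proved

[proof of `Summit.Langlands.Langlands.Theses.EvenIcosahedralCMCorner.SectorReduction`
(route `EvenIcosahedralCMCorner`, support item, rank 9): `CMOrdinaryDoor → ProAutomorphyAtKleinPrime →
ArtinPointClassicalityCM → UntwistAutomorphy → SolubleDescentMatching → NonDistinguishedComplement →
EvenIcosahedralStrongArtin`]

Pure logic — the route's deciding theorem `closes` with the junction `SectorJunction :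
EvenIcosahedralStrongArtin → Langlands` removed, so that an ITEM concludes the thesis BY NAME.  For an
irreducible even icosahedral `σ : Γ_ℚ → GL₂(ℂ)`: an abstract field isomorphism `ι : ℚ̄₃ ≃+* ℂ` exists
(the tree's `PadicAlgCl.nonempty_ringEquiv_complex`, Literature/FieldTheory/AlgClosed/PadicAlgClEquivComplex —
cited, not re-proved); case split on «`σ` is 3-distinguished» (unramified at
`3`, Frobenius charpoly `X² − tX + d` with `t² ≠ d`, `t² ≠ 4d`): in the distinguished sub-sector the
chain door (`CMOrdinaryDoor`) → engine (`ProAutomorphyAtKleinPrime`) → wall (`ArtinPointClassicalityCM`)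
→ `UntwistAutomorphy` → `SolubleDescentMatching` produces the automorphic realisation; otherwise the
declared residual `NonDistinguishedComplement` does.  No Literature named fact is consumed; axioms
`propext`, `Classical.choice`, `Quot.sound`. -/

set_option linter.dupNamespace false

namespace Summit.Langlands.Langlands.Theorems.EvenIcosahedralCMCornerSectorReduction

open Summit.Langlands.Langlands.Theses.EvenIcosahedralCMCorner

/-- **stmt-Langlands-14441** `EvenIcosahedralCMCorner.SectorReduction`: the 3-distinguished chain and
the declared residual sub-sector imply `EvenIcosahedralStrongArtin` (the body of `closes` without the
sector junction). -/
theorem sectorReduction : SectorReduction := by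
  intro hD hE hF hG hH hC σ hirr hico heven
  obtain ⟨ι⟩ := PadicAlgCl.nonempty_ringEquiv_complex 3
  by_cases h3 : ∀ v : IsDedekindDomain.HeightOneSpectrum (NumberField.RingOfIntegers ℚ),
      (3 : NumberField.RingOfIntegers ℚ) ∈ v.asIdeal → σ.IsUnramifiedAt v ∧ ∃ t d : ℂ,
        σ.HasFrobCharpolyAt v (Polynomial.X ^ 2 - Polynomial.C t * Polynomial.X + Polynomial.C d) ∧
          t ^ 2 ≠ d ∧ t ^ 2 ≠ 4 * d
  · obtain ⟨M, _, _, hCM, hGal, hSol, hζ, χ, τ, τ₃, htw, hav, hfin, hhyp⟩ := hD ι σ hirr hico heven h3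
    obtain ⟨M', _, _, _, hCM', hGal', hSol', hfin', hico', 𝒰, hpa⟩ :=
      hE ι M hCM hGal hSol hζ τ₃ hfin hhyp
    have hτ := hF ι M' hCM'
      (Literature.NumberTheory.GaloisRepresentations.FramedGaloisRep.restrictField M' τ)
      (Literature.NumberTheory.GaloisRepresentations.FramedGaloisRep.restrictField M' τ₃) (fun g ↦ hav _)
      hfin' hico' ⟨𝒰, hpa⟩
    have hσ := hG M' (Literature.NumberTheory.GaloisRepresentations.FramedGaloisRep.restrictField M'
      (Literature.NumberTheory.GaloisRepresentations.FramedGaloisRep.restrictField M σ))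
      (Literature.NumberTheory.GaloisRepresentations.FramedGaloisRep.restrictField M' τ)
      (Literature.NumberTheory.GaloisRepresentations.FramedGaloisRep.restrictField M' χ) (fun g ↦ htw _) hτ
    exact hH σ hirr hico M M' hGal' hSol' hσ
  · exact hC σ hirr hico heven h3

end Summit.Langlands.Langlands.Theorems.EvenIcosahedralCMCornerSectorReduction
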